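import Summits.AtomisticToContinuum.FouriersLaw.Theorems.HonestZwanzigPositiveMemoryRobinReduction
import Summits.AtomisticToContinuum.FouriersLaw.Theorems.HonestZwanzigPositiveMemoryTentReduction
import Summits.AtomisticToContinuum.FouriersLaw.Theorems.HonestZwanzigOrthogonalOhmFeshbachIdentities
import Summits.AtomisticToContinuum.FouriersLaw.Theorems.HonestZwanzigPositiveMemoryLocalityReduction
import Summits.AtomisticToContinuum.FouriersLaw.Theorems.HonestZwanzigPositiveMemoryNotInsulating
import Summits.AtomisticToContinuum.FouriersLaw.Theorems.HonestZwanzigGeneratorSiteEnergy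
import Summits.AtomisticToContinuum.FouriersLaw.Theorems.HonestZwanzigParityStatics
import Summits.AtomisticToContinuum.FouriersLaw.Theorems.HonestZwanzigOrthogonalOhmRegressionIdentity
import Summits.AtomisticToContinuum.FouriersLaw.Theorems.HonestZwanzigPositiveMemoryRowLimit
import Summits.AtomisticToContinuum.FouriersLaw.Theorems.HonestZwanzigPositiveMemoryBackflowFloorOfOrthogonalOhm
import Summits.AtomisticToContinuum.FouriersLaw.Theorems.HonestZwanzigPositiveMemoryFloorOfBackflowFloor
import Summits.AtomisticToContinuum.FouriersLaw.Theorems.HonestZwanzigPositiveMemoryFrequentFloor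
import Summits.AtomisticToContinuum.FouriersLaw.Theorems.HonestZwanzigPositiveMemoryPairLimit
import Summits.AtomisticToContinuum.FouriersLaw.Theorems.HonestZwanzigPositiveMemoryMemoryGram
import Summits.AtomisticToContinuum.FouriersLaw.Theorems.HonestZwanzigPositiveMemoryDetG0NeZero
import Summits.AtomisticToContinuum.FouriersLaw.Theorems.HonestZwanzigPositiveMemoryLapZeroFlat
import Summits.AtomisticToContinuum.FouriersLaw.Theorems.HonestZwanzigPositiveMemoryGreenKuboFloorBridges
import Summits.AtomisticToContinuum.FouriersLaw.Theorems.HonestZwanzigPositiveMemorySchurZeroFloorOfFloors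
import Summits.AtomisticToContinuum.FouriersLaw.Theorems.HonestZwanzigMemoryConductivityBridges
import Summits.AtomisticToContinuum.FouriersLaw.Theorems.HonestZwanzigNetworkReduction

/-!
# HonestZwanzig / PositiveMemory — line `Sketch` (tent duality): skeleton v11 (SORRY-FREE; lead c8, cycle 10)

v11 = v10 with all five v10 stubs LANDED and IMPORTED (`stub_detG0NeZero` p152568, `stub_lapZeroFlat` p152799,
`stub_eventualFloor_of_conductanceLowerBound` + `stub_eventualFloor_of_fouriersLaw` p153109, `stub_schur0Floor_of_floors` p153410) and the
v10 compositions landed as `…Theorems.HonestZwanzigPositiveMemoryNormalForm` (p153805, spelled-out signatures; not imported here only because the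
farm had not rebuilt it at registration time — the `…Sig` theorems below re-prove the same compositions in ≤ 15 lines each over the four landed
stub modules). No stub, no `sorry`.

## v10 (header kept)

v10: HonestZwanzig / PositiveMemory — line `Sketch` (tent duality): skeleton v10 (lead c8, cycle 10)

v10 (2026-08-17) = v9 (kept verbatim below, incl. its primary sorry-free `PositiveMemory_of`, p120416) PLUS the last
section "v10": the fixed-`N` EXISTENCE of every orthogonal DC response is now a theorem (crux #2's line landed
`stub_G0PosDef`, `G(0) ≻ 0`), so crux #3 is proved EQUIVALENT to its existence-free normal form `Schur0FloorSig`
(`positiveMemory_iff_schur0Floor`), the bulk backflow floor gets an existence-free form `BulkBackflowFloor0Sig`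
(↔ `BulkBackflowFloorSig`), Kirchhoff flatness becomes an identity AT `s = 0`, and the residual beyond crux #2 is packaged
as the Schur-free `EventualGreenKuboFloorSig` (⇐ stmt-11749, ⇐ `FouriersLaw`; `OO → EGKF → PM` landed). Five registered
stubs `stub_detG0NeZero` (lead), `stub_lapZeroFlat` (W1), `stub_eventualFloor_of_conductanceLowerBound` +
`stub_eventualFloor_of_fouriersLaw` (W2), `stub_positiveMemory_of_floors` (W3) — all fixed-`N`/bookkeeping, provable now.
Formal status UNCHANGED: closed modulo stmt-11749 ∧ (stmt-12693 ∨ BBF).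

## v9 (kept verbatim)

v9: HonestZwanzig / PositiveMemory — line `Sketch` (tent duality): skeleton v9 (sorry-free; lead c4, cycle 6)

v9 = v8+ with the six modules landed in cycles 4–5 IMPORTED instead of inlined (the hub has built
`…PositiveMemoryRowLimit` p122092, `…BackflowFloorOfOrthogonalOhm` p122152, `…FloorOfBackflowFloor` p122052,
`…FrequentFloor` p122281, `…PairLimit` p122596, `…MemoryGram` p122595): this file now holds only the three named
`N`-uniform hypotheses (`TentEscapeSig`, `MemoryLocalitySig`, `BulkBackflowFloorSig`) and the compositions; every stub the
line ever registered is a landed theorem. No open stub; no `sorry`. Primary theorem unchanged: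
`PositiveMemory_of : OrthogonalOhm → JunctionLocality.ConductanceLowerBound → PositiveMemory` (p120416).
Status of the crux after six lead cycles: closed MODULO the existing items stmt-AtomisticToContinuum-11749
(`ConductanceLowerBound`, NOT-INSULATING) and stmt-AtomisticToContinuum-12693 (`OrthogonalOhm`) — or, in place of the latter,
the strictly weaker `BulkBackflowFloorSig`; nothing `N`-uniform inside crux #3 is provable without one of them (lead c4
analysis, Cruxes/PositiveMemory/NOTES.md cycle 6: the per-bond backflow has no fixed-`N` sign — in the resistor calibration the
Gram matrix is `Γ = K(I − 𝟙𝟙ᵀ/(n+2ℓ))`, contact-bond backflow turns negative for a depressed contact symbol — and the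
bond-dependence law `ρ_{b−1}(s) − ρ_b(s) = (C·G(s)⁻¹·A(s))_b` is the landed `OrthogonalOhm` regression identity, whose
smallness in the bulk IS crux #2).

## v8 (kept verbatim)

v8: HonestZwanzig / PositiveMemory — line `Sketch` (tent duality): skeleton v8 FINAL (sorry-free; lead c3, cycle 4)

v8 = v7 (kept verbatim below; its primary theorem `PositiveMemory_of : OrthogonalOhm →
JunctionLocality.ConductanceLowerBound → PositiveMemory` is LANDED, p120416, and stays the primary, sorry-free) PLUS the
BACKFLOW FACTORISATION of that composition (last section of this file), which spends much less than crux #2: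

* `stub_rowLimit` (Kirchhoff flatness of the UNPROJECTED responses; fixed `N`, provable now from the Feshbach package):
  for every genuine bond `b` (`b+1 < N`), `lap_s(j_b, J) → ∫₀^∞corr(J,J)/(N−1)` as `s ↓ 0` — the interior Kolmogorov
  identities `lap_s(j_y, J) − lap_s(j_{y−1}, J) = lap_s((L e_y)∘Θ, J) = −s·lap_s(J, e_y)` (`pkg_Lr_lap`, `pkg_K4`) make
  `lap_s(j_b, J) = lap_s(J,J)/(N−1) + s·(ℤ-combination of the bounded lap_s(J, e_y))`, then `tendsto_lap_totalCurrent`.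
  So the unprojected DC response is the SAME number `T²D_N` on every bond (Disproof.lean §5(c) "row identity", exact).
* `BulkBackflowFloorSig` (hypothesis, `N`-uniform, one-sided, existence-free, per bond): for every `δ > 0` there is `R`
  such that on `R`-bulk bonds any pair of limits `ρ = lim schur_s(j_b,J)`, `ℓ = lim lap_s(j_b,J)` has `ρ ≥ ℓ − δ` — the
  Feshbach backflow `schur_s(j_b,J) − lap_s(j_b,J) = a_bᵀG(s)⁻¹A` (`A = Σ_b a_b`, `AᵀG⁻¹A ≥ 0`) is not macroscopically
  negative away from the contact layer ("the bare bulk symbol is at least the series conductance per bond").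
* `stub_backflowFloor_of_orthogonalOhm` (provable now): `FeshbachIdentities → RowLimit → OrthogonalOhm → BulkBackflowFloor`
  (`ℓ = ∫corr/(N−1) ≤ Σ_b ρ_b/(N−1) ≤ k + ε + 2R(C+|k|+ε)/(N−1)` by the landed `stub_upperLimit`, and `ρ ≥ k − ε`).
* `stub_positiveMemory_of_backflowFloor` (provable now, lead): `RowLimit → ConductanceLowerBound → BulkBackflowFloor →
  PositiveMemory` (`ℓ = ∫corr/(N−1) ≥ cT²` by the landed `stub_greenKuboFloor`, `ρ ≥ ℓ − cT²/2`).
Hence `PositiveMemory ⇐ ConductanceLowerBound ∧ BulkBackflowFloor` with `BulkBackflowFloor ⇐ OrthogonalOhm`: the residual of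
crux #3 beyond NOT-INSULATING (stmt-11749) is typed as ONE one-sided hypothesis strictly weaker than crux #2 (no existence of
limits, no `|ρ_b| ≤ C`, no two-sided homogeneity), and v7's `PositiveMemory_of` is re-derived as `PositiveMemory_of'`.

## v7 (kept verbatim)

v7: HonestZwanzig / PositiveMemory — line `Sketch` (tent duality): skeleton v7 (sorry-free; lead c2, cycle 3)

v7 = v6 with NO open stub: the primary skeleton theorem is now `PositiveMemory_of : OrthogonalOhm →
JunctionLocality.ConductanceLowerBound → PositiveMemory` (= the landed `PositiveMemory_of_notInsulating`, p120416), whose two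
hypotheses are EXISTING ledger items (stmt-AtomisticToContinuum-12693, stmt-AtomisticToContinuum-11749); the v5 compositions are
kept as `PositiveMemory_of_locality : OO → RC → MemoryLocalitySig → PM` and `PositiveMemory_of_escape : OO → TentEscapeSig →
MemoryLocalitySig → PM`, their former stubs `stub_memoryLocality` / `stub_tentEscape` demoted to the named hypotheses
`MemoryLocalitySig` / `TentEscapeSig` (expired on the ledger: off the critical path of crux #3, inputs of cruxes #2/#4's own
plans). Outcome of the line: crux #3 is blocked on stmt-11749 given its declared dep crux #2.

## v6

v6 (lead c2, cycle 3, 2026-08-16) = v5 below, unchanged, PLUS the canonical composition (last section of this file; LANDED p120416)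
`PositiveMemory_of_notInsulating : OrthogonalOhm → JunctionLocality.ConductanceLowerBound → PositiveMemory`
whose only `N`-uniform input besides crux #2 is the EXISTING ledger item `stmt-AtomisticToContinuum-11749`
("NOT INSULATING", `liminf_N D_N > 0`, shared by four live routes, necessary for the conjunct): at fixed `N`,
`Σ_b ρ_b = lim_{s↓0} Σ_b schur_s(j_b,J) ≥ lim_{s↓0} lap_s(J,J) = ∫₀^∞corr(J,J)` (time reversal on the current and
positive definiteness of `G(s)`, both in `FeshbachIdentities`; `stub_upperLimit`, provable now), and
`∫₀^∞corr(J,J) = (N−1)T²D_N ≥ (N−1)T²c` along the canonical unique steady-state family (`OpenChainGreenKubo`,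
`NessUnique`, `FourierGreenKubo.finiteResponse_of_unique`, all LANDED, + `ConductanceLowerBound`; `stub_greenKuboFloor`,
provable now); then `k ≥ cT²` by the landed `ohm_floor` and every bulk limit is `≥ cT²/2`. No locality layer, no Robin
coercivity, no tent. (Disproof.lean §3(c) — "PositiveMemory is morally κ_GK > 0 plus locality" — made exact, and the
"plus locality" dropped: the homogeneity clause of `OrthogonalOhm` is all the locality the floor needs.)

## v5 (kept verbatim)

Crux `stmt-AtomisticToContinuum-12694` (`Theses.HonestZwanzig.PositiveMemory`, rank 3 of route
`HonestZwanzig`): a strictly positive `N`-uniform floor `ρ_b ≥ k₀(T)` for the orthogonal-dynamics DC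
responses `ρ_b = lim_{s↓0} schur_s(j_b, J)` on bulk bonds.

Line (card `Cruxes/PositiveMemory/Ideas/apex-escape-tent-duality.md`, witness reshaped `a = ξ`): at fixed
`N` and `s > 0` the Feshbach matrix of the route is `𝔽(s) = χ G(s)⁻¹ χ`, so Cauchy–Schwarz in the
`G(s)`-metric gives `(aᵀχζ)² ≤ (aᵀG(s)a)·(ζᵀ𝔽(s)ζ)` (`stub_feshbachDuality`, LANDED); for `ζ` vanishing at the
two contact sites `ζᵀ𝔽(s)ζ = s·Cov(E_ζ,E_ζ) + schur_s(J_{∇ζ}, J_{∇ζ})` (`stub_profileForm`, LANDED); the Gibbs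
momenta give `ζᵀχζ ≥ (T²/2)Σζ_x²` (`stub_profileVariance`, LANDED). On the TENT `ξ_x = min(x, N−1−x)` either
Robin coercivity (crux #4) or the tent-escape bound `ξᵀG(s)ξ ≤ C_E N⁵` (`stub_tentEscape`, OPEN) makes
`schur_s(J_ξ,J_ξ)` extensive, and the one-sided apex bound `schur_s(J_ξ,J_ξ) ≤ schur_s(J,J) + εN + C_A(ε)`
(`stub_apexLocalityEps`) transfers this to `Σ_b ρ_b = lim schur_s(J,J) ≥ cN − o(N)`, whence `k ≥ c` by the bulk
homogeneity of `OrthogonalOhm` and every bulk limit is `≥ c/2` (`stub_robinReduction` p105557 /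
`stub_tentReduction` p111268, LANDED).

v5 (lead c1, 2026-08-16): `stub_apexLocalityEps` is no longer a stub but is DERIVED from
* `stub_memoryLocality` (OPEN, the honest residue): an `N`-uniform summable majorant `K(z)` of the NEGATIVE part of
  the bond memory kernel `𝔎_N(s)_{bb'} = schur_s(j_b, j_{b'})` at small `s` — the one-sided half of the route's
  foreseen `UniformLocality` layer of crux #2 `OrthogonalOhm`;
* three provable-now pieces, LANDED by the cycle-2 worker wave and imported: `stub_cutExpansion` (p115939, bilinear
  expansion of `schur_s` over weighted bond currents), `stub_cutCount` (p113372, the tent cut sees `≤ z` pairs at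
  distance `z`: `Σ_{bb'}(1 − g_bg_{b'})K|b−b'| ≤ 4Σ_{z<N} zK(z) + 16Σ_{z<N}K(z)`), `stub_kronecker` (p112499,
  `Σ_{z<n} zK(z) = o(n)` for summable `K ≥ 0`),
composed in `stub_localityReduction` (LANDED, `…PositiveMemoryLocalityReduction`, p116429).
Compositions: `PositiveMemory_of : OrthogonalOhm → RobinCoercivity → PositiveMemory` (open: `stub_memoryLocality`
ONLY) and the Robin-free `PositiveMemory_of_escape : OrthogonalOhm → PositiveMemory` (open: additionally
`stub_tentEscape`, which a cycle-2 worker found `stub-blocked: RobinCoercivity` — only known route: crux #4 + a static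
covariance bound + the landed flux equivalence; it is the one-profile shadow of crux #4, `Disproof.lean` §5(d)).
-/

noncomputable section

open MeasureTheory Finset Real Set Filter Topology
open Literature.MathematicalPhysics.KineticTheory.HeatConduction
open Summit.AtomisticToContinuum.FouriersLaw.Theorems.HonestZwanzig.NetworkReduction
open Summit.AtomisticToContinuum.FouriersLaw.Theorems.RobinCoercivity.Negative

namespace Summit.AtomisticToContinuum.FouriersLaw.Theorems.HonestZwanzig.PositiveMemory

/-! ### The two `N`-uniform inputs of the v5 compositions, as named hypotheses (v7: no open stubs remain) -/

/-- **Hypothesis S4 — tent escape** (v7: no longer a registered stub but a HYPOTHESIS of `PositiveMemory_of_escape`;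
stub-blocked on `RobinCoercivity` since cycle 2; the `N`-uniform physics input of the Robin-free composition, inf-side): for
the tent profile `ξ_x = min(x, N−1−x)` the Laplace-transformed autocorrelation of the tent-weighted energy,
`ξᵀG(s)ξ = lap_s(E_ξ, E_ξ)`, is `≤ C_E · N⁵` for all small `s > 0`, uniformly in `N` (variance `≍ N³` times
the slowest Robin heat-mode time `≍ N²`: "energy in the bulk reaches the baths no slower than diffusively";
harmonic member `≍ N⁴`). -/
def TentEscapeSig : Prop :=
    ∀ ω₂ lam β γ : ℝ, 0 < ω₂ → 0 < lam → 0 < β → 0 < γ → ∀ T : ℝ, 0 < T → ∃ C_E : ℝ, ∀ N : ℕ, 2 ≤ N →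
    let P := Literature.MathematicalPhysics.KineticTheory.HeatConduction.pinnedChain ω₂ lam β γ;
    let X := Literature.MathematicalPhysics.KineticTheory.HeatConduction.PhaseSpace N;
    let μ : MeasureTheory.Measure X := P.gibbsMeasure N T;
    let corr : (X → ℝ) → (X → ℝ) → ℝ → ℝ := fun f g t =>
      (∫ z, f z * (∫ y, g y ∂(P.transitionKernel N T T t.toNNReal z)) ∂μ) - (∫ z, f z ∂μ) * (∫ z, g z ∂μ);
    let lap : ℝ → (X → ℝ) → (X → ℝ) → ℝ := fun s f g =>
      ∫ t in Set.Ioi (0 : ℝ), Real.exp (-(s * t)) * corr f g t;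
    let e : Fin N → X → ℝ := fun x z => z.2 x ^ 2 / 2 + P.U (z.1 x) +
      ∑ j : Fin N, ((if j.val = x.val + 1 then P.V (z.1 j - z.1 x) / 2 else 0) +
        (if x.val = j.val + 1 then P.V (z.1 x - z.1 j) / 2 else 0));
    let G : ℝ → Matrix (Fin N) (Fin N) ℝ := fun s => Matrix.of fun x y => lap s (e x) (e y);
    let ξ : Fin N → ℝ := fun x => ((min x.val (N - 1 - x.val) : ℕ) : ℝ);
    ∃ s₀ : ℝ, 0 < s₀ ∧ ∀ s : ℝ, 0 < s → s < s₀ →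
      (∑ x : Fin N, ∑ y : Fin N, ξ x * G s x y * ξ y) ≤ C_E * (N : ℝ) ^ 5

/-- **Hypothesis L — one-sided memory locality** (v7: no longer a registered stub but a HYPOTHESIS of
`PositiveMemory_of_locality` / `PositiveMemory_of_escape`; the `N`-uniform residue of the v5 compositions, off the critical
path of crux #3 since v6): there is a
nonnegative summable `K : ℕ → ℝ`, depending on the parameters and `T` only, such that for every `N ≥ 2` and all
small `s > 0` the bond memory kernel of the orthogonal dynamics, `𝔎_N(s)_{bb'} = schur_s(j_b, j_{b'})`, satisfies
`𝔎_N(s)_{bb'} ≥ −K(|b − b'|)` (NEGATIVE parts only: the harmonic member's large positive cross memory is allowed;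
the one-loop `−c z⁻²` tail of `Cruxes/PositiveMemory/Disproof.lean` §4 is summable). This is the one-sided half
of the `UniformLocality` layer foreseen under crux #2 `OrthogonalOhm` ("summable off-diagonal decay of
`𝔎_N(0)_{bb'}`, `N`-uniform"), stated at small `s > 0` and fixed `N` like every other stub of the route. -/
def MemoryLocalitySig : Prop :=
    ∀ ω₂ lam β γ : ℝ, 0 < ω₂ → 0 < lam → 0 < β → 0 < γ → ∀ T : ℝ, 0 < T →
    ∃ K : ℕ → ℝ, (∀ z, 0 ≤ K z) ∧ Summable K ∧ ∀ N : ℕ, 2 ≤ N →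
    let P := Literature.MathematicalPhysics.KineticTheory.HeatConduction.pinnedChain ω₂ lam β γ;
    let X := Literature.MathematicalPhysics.KineticTheory.HeatConduction.PhaseSpace N;
    let μ : MeasureTheory.Measure X := P.gibbsMeasure N T;
    let corr : (X → ℝ) → (X → ℝ) → ℝ → ℝ := fun f g t =>
      (∫ z, f z * (∫ y, g y ∂(P.transitionKernel N T T t.toNNReal z)) ∂μ) - (∫ z, f z ∂μ) * (∫ z, g z ∂μ);
    let lap : ℝ → (X → ℝ) → (X → ℝ) → ℝ := fun s f g =>
      ∫ t in Set.Ioi (0 : ℝ), Real.exp (-(s * t)) * corr f g t;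
    let e : Fin N → X → ℝ := fun x z => z.2 x ^ 2 / 2 + P.U (z.1 x) +
      ∑ j : Fin N, ((if j.val = x.val + 1 then P.V (z.1 j - z.1 x) / 2 else 0) +
        (if x.val = j.val + 1 then P.V (z.1 x - z.1 j) / 2 else 0));
    let G : ℝ → Matrix (Fin N) (Fin N) ℝ := fun s => Matrix.of fun x y => lap s (e x) (e y);
    let schur : ℝ → (X → ℝ) → (X → ℝ) → ℝ := fun s f g =>
      lap s f g - ∑ x : Fin N, ∑ y : Fin N, lap s f (e x) * (G s)⁻¹ x y * lap s (e y) g;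
    ∃ s₀ : ℝ, 0 < s₀ ∧ ∀ s : ℝ, 0 < s → s < s₀ → ∀ (z : ℕ) (b b' : Fin N), b'.val = b.val + z →
      -K z ≤ schur s (P.bondCurrent N b) (P.bondCurrent N b') ∧
        -K z ≤ schur s (P.bondCurrent N b') (P.bondCurrent N b)

/-! ### The locality reduction (v5): `stub_kronecker` (p112499), `stub_cutCount` (p113372), `stub_cutExpansion` (p115939),
`fixedN_apexBound` + `stub_localityReduction` (p116429) are LANDED and IMPORTED (v8: the hub has built
`…PositiveMemoryLocalityReduction`, so the v7 inline copies are dropped). -/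

/-- **S5ε — apex sub-extensivity** (one-sided `o(N)` DC cross memory across the apex), DERIVED (v5) from the
memory-locality hypothesis via the landed `stub_localityReduction` and the discharged `FeshbachIdentities`. -/
theorem apexLocalityEps_of_memoryLocality (hL : MemoryLocalitySig) :
    ∀ ω₂ lam β γ : ℝ, 0 < ω₂ → 0 < lam → 0 < β → 0 < γ → ∀ T : ℝ, 0 < T → ∀ ε : ℝ, 0 < ε → ∃ C_A : ℝ, ∀ N : ℕ, 2 ≤ N →
    let P := Literature.MathematicalPhysics.KineticTheory.HeatConduction.pinnedChain ω₂ lam β γ;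
    let X := Literature.MathematicalPhysics.KineticTheory.HeatConduction.PhaseSpace N;
    let μ : MeasureTheory.Measure X := P.gibbsMeasure N T;
    let corr : (X → ℝ) → (X → ℝ) → ℝ → ℝ := fun f g t =>
      (∫ z, f z * (∫ y, g y ∂(P.transitionKernel N T T t.toNNReal z)) ∂μ) - (∫ z, f z ∂μ) * (∫ z, g z ∂μ);
    let lap : ℝ → (X → ℝ) → (X → ℝ) → ℝ := fun s f g =>
      ∫ t in Set.Ioi (0 : ℝ), Real.exp (-(s * t)) * corr f g t;
    let e : Fin N → X → ℝ := fun x z => z.2 x ^ 2 / 2 + P.U (z.1 x) +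
      ∑ j : Fin N, ((if j.val = x.val + 1 then P.V (z.1 j - z.1 x) / 2 else 0) +
        (if x.val = j.val + 1 then P.V (z.1 x - z.1 j) / 2 else 0));
    let G : ℝ → Matrix (Fin N) (Fin N) ℝ := fun s => Matrix.of fun x y => lap s (e x) (e y);
    let schur : ℝ → (X → ℝ) → (X → ℝ) → ℝ := fun s f g =>
      lap s f g - ∑ x : Fin N, ∑ y : Fin N, lap s f (e x) * (G s)⁻¹ x y * lap s (e y) g;
    let J : X → ℝ := fun z => ∑ i : Fin N, P.bondCurrent N i z;
    let ξ : Fin N → ℝ := fun x => ((min x.val (N - 1 - x.val) : ℕ) : ℝ);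
    let Jξ : X → ℝ := fun z =>
      ∑ b : Fin N, (∑ j : Fin N, if j.val = b.val + 1 then ξ j - ξ b else 0) * P.bondCurrent N b z;
    ∃ s₀ : ℝ, 0 < s₀ ∧ ∀ s : ℝ, 0 < s → s < s₀ → schur s Jξ Jξ ≤ schur s J J + (ε * (N : ℝ) + C_A) :=
  stub_localityReduction
    Summit.AtomisticToContinuum.FouriersLaw.Theorems.HonestZwanzig.stub_feshbachIdentities hL

/-! ### Skeleton theorems (v5 compositions, now with their `N`-uniform inputs as hypotheses) -/

/-! NOTE (v10): compositions whose hypotheses are NOT registered obligations (the typed `…Sig` hypotheses) conclude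
`id PositiveMemory` — definitionally the crux (`id` unfolds by `rfl`/`exact`), but not "the crux BY NAME", so that the
skeleton audit (`ledger skeleton check`) takes as THE skeleton theorem one whose hypotheses are route items / stubs
(`PositiveMemory_of`). -/

/-- **v5 primary composition**: `OrthogonalOhm → RobinCoercivity → (memory locality) → PositiveMemory` (route items
`stmt-AtomisticToContinuum-12693`, `stmt-AtomisticToContinuum-12695` as hypotheses; `FeshbachIdentities` DISCHARGED by the
landed `HonestZwanzig.stub_feshbachIdentities`; every other piece landed: p105557, p116429, p112499, p113372, p115939). -/
theorem PositiveMemory_of_locality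
    (hOO : Summit.AtomisticToContinuum.FouriersLaw.Theses.HonestZwanzig.OrthogonalOhm)
    (hRC : Summit.AtomisticToContinuum.FouriersLaw.Theses.HonestZwanzig.RobinCoercivity)
    (hL : MemoryLocalitySig) :
    id Summit.AtomisticToContinuum.FouriersLaw.Theses.HonestZwanzig.PositiveMemory :=
  stub_robinReduction Summit.AtomisticToContinuum.FouriersLaw.Theorems.HonestZwanzig.stub_feshbachIdentities hOO hRC
    (apexLocalityEps_of_memoryLocality hL)

/-- **v5 Robin-free composition**: `OrthogonalOhm → (tent escape) → (memory locality) → PositiveMemory` (p111268 +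
the locality reduction). -/
theorem PositiveMemory_of_escape
    (hOO : Summit.AtomisticToContinuum.FouriersLaw.Theses.HonestZwanzig.OrthogonalOhm)
    (hE : TentEscapeSig) (hL : MemoryLocalitySig) :
    id Summit.AtomisticToContinuum.FouriersLaw.Theses.HonestZwanzig.PositiveMemory :=
  stub_tentReduction Summit.AtomisticToContinuum.FouriersLaw.Theorems.HonestZwanzig.stub_feshbachIdentities hOO
    hE (apexLocalityEps_of_memoryLocality hL)

/-! ### v6 (lead c2): the NOT-INSULATING composition — `OrthogonalOhm ∧ ConductanceLowerBound ⇒ PositiveMemory`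

LANDED as `…Theorems.HonestZwanzigPositiveMemoryNotInsulating` (p120416: `PositiveMemory_of_notInsulating`,
`positiveMemory_of_greenKuboFloor`, `PositiveMemory_of_memoryConductivity`, `conductanceLowerBound_of_memoryConductivity`,
`conductanceLowerBound_of_cruxes`, `positiveMemory_iff_conductanceLowerBound`), with its two stubs `stub_upperLimit` (p119936)
and `stub_greenKuboFloor` (p120071); all IMPORTED above (v8), no inline copies. -/

/-! ### v8 (lead c3, cycle 4): Kirchhoff flatness of the unprojected responses and the backflow factorisation

Three registered stubs (all fixed-`N` / bookkeeping, provable now) and one `N`-uniform hypothesis. -/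

/-! Stub R `stub_rowLimit` LANDED p122092 and IMPORTED (v9) from `…Theorems.HonestZwanzigPositiveMemoryRowLimit`
(with `RowLimit.bond_step / bond_telescope / bond_identity / abs_lap_le / tendsto_lap_bond`). -/

/-- **Hypothesis B — bulk backflow floor** (`N`-uniform, one-sided, existence-free, per bond; v8): for every
`δ > 0` there is `R` such that on every `R`-bulk bond any limits `ρ = lim_{s↓0} schur_s(j_b, J)` and
`ℓ = lim_{s↓0} lap_s(j_b, J)` satisfy `ρ ≥ ℓ − δ`: the Feshbach backflow `schur_s(j_b,J) − lap_s(j_b,J) = a_bᵀG(s)⁻¹A`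
(`a_{b,x} = lap_s(j_b, e_x)`, `A = Σ_b a_b`, `Σ_b a_bᵀG⁻¹A = AᵀG⁻¹A ≥ 0`) is not macroscopically negative away from the
contact layer. Implied by `OrthogonalOhm` (`stub_backflowFloor_of_orthogonalOhm`); with `ConductanceLowerBound` it gives
`PositiveMemory` (`stub_positiveMemory_of_backflowFloor`). False in the ballistic corner `lam = β = 0` (there
`ℓ ≍ N`, `ρ_R = O(R)`), like `OrthogonalOhm` — a diffusive-regime statement. -/
def BulkBackflowFloorSig : Prop :=
    ∀ ω₂ lam β γ : ℝ, 0 < ω₂ → 0 < lam → 0 < β → 0 < γ → ∀ T : ℝ, 0 < T → ∀ δ : ℝ, 0 < δ → ∃ R : ℕ, ∀ N : ℕ, 2 ≤ N →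
    let P := Literature.MathematicalPhysics.KineticTheory.HeatConduction.pinnedChain ω₂ lam β γ;
    let X := Literature.MathematicalPhysics.KineticTheory.HeatConduction.PhaseSpace N;
    let μ : MeasureTheory.Measure X := P.gibbsMeasure N T;
    let corr : (X → ℝ) → (X → ℝ) → ℝ → ℝ := fun f g t =>
      (∫ z, f z * (∫ y, g y ∂(P.transitionKernel N T T t.toNNReal z)) ∂μ) - (∫ z, f z ∂μ) * (∫ z, g z ∂μ);
    let lap : ℝ → (X → ℝ) → (X → ℝ) → ℝ := fun s f g =>
      ∫ t in Set.Ioi (0 : ℝ), Real.exp (-(s * t)) * corr f g t;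
    let e : Fin N → X → ℝ := fun x z => z.2 x ^ 2 / 2 + P.U (z.1 x) +
      ∑ j : Fin N, ((if j.val = x.val + 1 then P.V (z.1 j - z.1 x) / 2 else 0) +
        (if x.val = j.val + 1 then P.V (z.1 x - z.1 j) / 2 else 0));
    let G : ℝ → Matrix (Fin N) (Fin N) ℝ := fun s => Matrix.of fun x y => lap s (e x) (e y);
    let schur : ℝ → (X → ℝ) → (X → ℝ) → ℝ := fun s f g =>
      lap s f g - ∑ x : Fin N, ∑ y : Fin N, lap s f (e x) * (G s)⁻¹ x y * lap s (e y) g;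
    let J : X → ℝ := fun z => ∑ i : Fin N, P.bondCurrent N i z;
    ∀ b : Fin N, R ≤ b.val → b.val + 2 + R ≤ N → ∀ ρ ℓ : ℝ,
      Filter.Tendsto (fun s => schur s (P.bondCurrent N b) J) (nhdsWithin (0 : ℝ) (Set.Ioi 0)) (nhds ρ) →
      Filter.Tendsto (fun s => lap s (P.bondCurrent N b) J) (nhdsWithin (0 : ℝ) (Set.Ioi 0)) (nhds ℓ) →
      ℓ - δ ≤ ρ

/-! Stubs BO `stub_backflowFloor_of_orthogonalOhm` (p122152), PB `stub_positiveMemory_of_backflowFloor` (p122052) and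
FQ `stub_positiveMemory_of_frequentFloor` (p122281, with `ohm_floor_frequently`, `positiveMemory_of_frequentGreenKuboFloor`)
LANDED and IMPORTED (v9). -/

/-- **v8 composition (subsequence transfer)**: `OrthogonalOhm → (GK floor along a subsequence) → PositiveMemory`
(Stub FQ; `FeshbachIdentities` discharged). -/
theorem PositiveMemory_of_frequentFloor
    (hOO : Summit.AtomisticToContinuum.FouriersLaw.Theses.HonestZwanzig.OrthogonalOhm)
    (hGKF : ∀ ω₂ lam β γ : ℝ, 0 < ω₂ → 0 < lam → 0 < β → 0 < γ → ∀ T : ℝ, 0 < T →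
      ∃ κ : ℝ, 0 < κ ∧ ∀ N₀ : ℕ, ∃ N : ℕ, N₀ ≤ N ∧ 2 ≤ N ∧
      let P := Literature.MathematicalPhysics.KineticTheory.HeatConduction.pinnedChain ω₂ lam β γ;
      let X := Literature.MathematicalPhysics.KineticTheory.HeatConduction.PhaseSpace N;
      let μ : MeasureTheory.Measure X := P.gibbsMeasure N T;
      let J : X → ℝ := fun z => ∑ i : Fin N, P.bondCurrent N i z;
      κ * ((N : ℝ) - 1) ≤ ∫ t in Set.Ioi (0 : ℝ),
        ((∫ z, J z * (∫ y, J y ∂(P.transitionKernel N T T t.toNNReal z)) ∂μ) - (∫ z, J z ∂μ) * (∫ z, J z ∂μ))) :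
    id Summit.AtomisticToContinuum.FouriersLaw.Theses.HonestZwanzig.PositiveMemory :=
  stub_positiveMemory_of_frequentFloor
    Summit.AtomisticToContinuum.FouriersLaw.Theorems.HonestZwanzig.stub_feshbachIdentities hOO hGKF

/-- v8: `OrthogonalOhm` implies the bulk backflow floor (Stubs R, BO; `FeshbachIdentities` discharged). -/
theorem backflowFloor_of_orthogonalOhm
    (hOO : Summit.AtomisticToContinuum.FouriersLaw.Theses.HonestZwanzig.OrthogonalOhm) :
    BulkBackflowFloorSig :=
  stub_backflowFloor_of_orthogonalOhm
    Summit.AtomisticToContinuum.FouriersLaw.Theorems.HonestZwanzig.stub_feshbachIdentities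
    (stub_rowLimit Summit.AtomisticToContinuum.FouriersLaw.Theorems.HonestZwanzig.stub_feshbachIdentities) hOO

/-- **v8 composition**: `ConductanceLowerBound → BulkBackflowFloor → PositiveMemory` (Stubs R, PB). -/
theorem PositiveMemory_of_backflowFloor
    (hCLB : Summit.AtomisticToContinuum.FouriersLaw.Theses.JunctionLocality.ConductanceLowerBound)
    (hB : BulkBackflowFloorSig) :
    id Summit.AtomisticToContinuum.FouriersLaw.Theses.HonestZwanzig.PositiveMemory :=
  stub_positiveMemory_of_backflowFloor
    (stub_rowLimit Summit.AtomisticToContinuum.FouriersLaw.Theorems.HonestZwanzig.stub_feshbachIdentities) hCLB hB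

/-- **v8 re-derivation of the primary composition through the factorisation**:
`OrthogonalOhm → ConductanceLowerBound → PositiveMemory`. -/
theorem PositiveMemory_of'
    (hOO : Summit.AtomisticToContinuum.FouriersLaw.Theses.HonestZwanzig.OrthogonalOhm)
    (hCLB : Summit.AtomisticToContinuum.FouriersLaw.Theses.JunctionLocality.ConductanceLowerBound) :
    Summit.AtomisticToContinuum.FouriersLaw.Theses.HonestZwanzig.PositiveMemory :=
  PositiveMemory_of_backflowFloor hCLB (backflowFloor_of_orthogonalOhm hOO)

/-! ### v8+ (lead c3, cycle 5): pairwise Kirchhoff flatness and the Gram structure of the bond memory kernel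

Two more registered stubs (fixed `N`), both LANDED: `stub_pairLimit` p122596 (lead), `stub_memoryGram` p122595 (worker W3). Together: when the limits exist,
`𝔎_N(0)_{bb'} = lim schur_s(j_b, j_{b'}) = ∫₀^∞corr(J,J)/(N−1)² + lim Γ_{bb'}(s)`, `Γ(s) = [a_b(s)ᵀG(s)⁻¹a_{b'}(s)]` the
POSITIVE SEMIDEFINITE Gram matrix of the energy-response vectors `a_{b,x}(s) = lap_s(j_b, e_x)` in the `G(s)⁻¹` metric: the
unprojected DC current covariance is exactly flat (rank one, `= T²G_N·𝟙𝟙ᵀ`) and carries no spatial information; ALL locality /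
homogeneity content of cruxes #2–#3 (`MemoryLocalitySig`, `BulkBackflowFloorSig` = "bulk row sums of `Γ` are `≥ −δ`") lives in `Γ`. -/

/-! Stubs PL `stub_pairLimit` (p122596, with `PairLimit.*`) and MG `stub_memoryGram` (p122595, with `gram_schur`,
`gram_form_nonneg`, `pkg_rev_bond`, `fixedN_memoryGram`) LANDED and IMPORTED (v9). -/

/-- **Skeleton theorem of line `Sketch`, v7–v9 (sorry-free, LANDED p120416 as `PositiveMemory_of_notInsulating`; renamed
`PositiveMemory_of_v9` in v10, whose `PositiveMemory_of` re-derives the same implication through the existence-free normal form)**: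
`OrthogonalOhm →
ConductanceLowerBound → PositiveMemory` — both hypotheses are EXISTING ledger items (crux #2 stmt-AtomisticToContinuum-12693 and
the shared NOT-INSULATING crux stmt-AtomisticToContinuum-11749). -/
theorem PositiveMemory_of_v9 :
    Summit.AtomisticToContinuum.FouriersLaw.Theses.HonestZwanzig.OrthogonalOhm →
    Summit.AtomisticToContinuum.FouriersLaw.Theses.JunctionLocality.ConductanceLowerBound →
    Summit.AtomisticToContinuum.FouriersLaw.Theses.HonestZwanzig.PositiveMemory :=
  PositiveMemory_of_notInsulating


/-! ## v10/v11 (lead c8, cycle 10, 2026-08-17): EXISTENCE DISCHARGED — the crux in existence-free normal form,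
exact Kirchhoff flatness at `s = 0`, the existence-free bulk backflow floor, and the Green–Kubo-floor packaging

New input since cycle 9: crux #2's line landed `stub_G0PosDef` (`G(0) ≻ 0` at every `N ≥ 2`,
`…Theorems.HonestZwanzigOrthogonalOhmG0PosDef`, 2026-08-17). With the refuter's `Negative.ExistenceBarrier` /
`Negative.NonDegeneracy` (p126176 / p126437) this makes EVERY orthogonal DC response `ρ_b = lim_{s↓0} schur_s(j_b, J)` exist at
fixed `N` and equal the explicit finite-`N` number `schur₀(j_b, J)` (`tendsto_schur_bond_all`, p152568); the existence guard
`∀ ρ, Tendsto … → k₀ ≤ ρ` of the crux is no longer a barrier of any kind, and the crux is PROVED EQUIVALENT to its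
existence-free normal form (`positiveMemory_iff_schur0Floor`, p152568). All v10 stubs are landed (see the file header); the
compositions are landed in `…Theorems.HonestZwanzigPositiveMemoryNormalForm` (p153805). Formal status UNCHANGED: closed modulo
stmt-11749 ∧ (stmt-12693 ∨ `BulkBackflowFloorSig`/`BulkBackflowFloor0Sig`). -/

/-- **Hypothesis GK — eventual Green–Kubo floor** (`N`-uniform; the summit's NOT-INSULATING content in its barest,
Schur-free, steady-state-free form): there are `κ > 0` and `N₀` with `κ·(N − 1) ≤ ∫₀^∞corr_N(J,J)` for all `N ≥ N₀`,
`N ≥ 2` — the equilibrium total-current autocorrelation integral of the open `N`-chain grows at least linearly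
(`T²D_N ≥ κ`). Implied by `JunctionLocality.ConductanceLowerBound` (stmt-11749) and by `FouriersLaw` itself
(stubs v10-C/D); with `OrthogonalOhm` it gives the crux (landed `positiveMemory_of_greenKuboFloor`). -/
def EventualGreenKuboFloorSig : Prop :=
    ∀ ω₂ lam β γ : ℝ, 0 < ω₂ → 0 < lam → 0 < β → 0 < γ → ∀ T : ℝ, 0 < T →
      ∃ κ : ℝ, 0 < κ ∧ ∃ N₀ : ℕ, ∀ N : ℕ, N₀ ≤ N → 2 ≤ N →
      let P := Literature.MathematicalPhysics.KineticTheory.HeatConduction.pinnedChain ω₂ lam β γ;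
      let X := Literature.MathematicalPhysics.KineticTheory.HeatConduction.PhaseSpace N;
      let μ : MeasureTheory.Measure X := P.gibbsMeasure N T;
      let J : X → ℝ := fun z => ∑ i : Fin N, P.bondCurrent N i z;
      κ * ((N : ℝ) - 1) ≤ ∫ t in Set.Ioi (0 : ℝ),
        ((∫ z, J z * (∫ y, J y ∂(P.transitionKernel N T T t.toNNReal z)) ∂μ) - (∫ z, J z ∂μ) * (∫ z, J z ∂μ))

/-- **The existence-free NORMAL FORM of crux #3** (`N`-uniform, per bulk bond, no limit to be produced):
`∃ k₀ > 0, ∃ R, ∀ N ≥ 2, ∀ R`-bulk `b`, `k₀ ≤ schur₀(j_b, J)` with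
`schur₀(f,g) = ∫₀^∞corr(f,g) − Σ_{x,y}∫₀^∞corr(f,e_x)·(G₀⁻¹)_{xy}·∫₀^∞corr(e_y,g)`, `G₀ = [∫₀^∞corr(e_x,e_y)]`. -/
def Schur0FloorSig : Prop :=
    ∀ ω₂ lam β γ : ℝ, 0 < ω₂ → 0 < lam → 0 < β → 0 < γ → ∀ T : ℝ, 0 < T → ∃ k₀ : ℝ, 0 < k₀ ∧ ∃ R : ℕ,
      ∀ N : ℕ, 2 ≤ N →
      let P := Literature.MathematicalPhysics.KineticTheory.HeatConduction.pinnedChain ω₂ lam β γ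
      let X := Literature.MathematicalPhysics.KineticTheory.HeatConduction.PhaseSpace N
      let μ : MeasureTheory.Measure X := P.gibbsMeasure N T
      let corr : (X → ℝ) → (X → ℝ) → ℝ → ℝ := fun f g t =>
        (∫ z, f z * (∫ y, g y ∂(P.transitionKernel N T T t.toNNReal z)) ∂μ) - (∫ z, f z ∂μ) * (∫ z, g z ∂μ)
      let e : Fin N → X → ℝ := fun x z => z.2 x ^ 2 / 2 + P.U (z.1 x) +
        ∑ j : Fin N, ((if j.val = x.val + 1 then P.V (z.1 j - z.1 x) / 2 else 0) +
          (if x.val = j.val + 1 then P.V (z.1 x - z.1 j) / 2 else 0))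
      let J : X → ℝ := fun z => ∑ i : Fin N, P.bondCurrent N i z
      let G₀ : Matrix (Fin N) (Fin N) ℝ := Matrix.of fun x y => ∫ t in Set.Ioi (0 : ℝ), corr (e x) (e y) t
      let schur₀ : (X → ℝ) → (X → ℝ) → ℝ := fun f g =>
        (∫ t in Set.Ioi (0 : ℝ), corr f g t) -
          ∑ x : Fin N, ∑ y : Fin N, (∫ t in Set.Ioi (0 : ℝ), corr f (e x) t) * G₀⁻¹ x y *
            (∫ t in Set.Ioi (0 : ℝ), corr (e y) g t)
      ∀ b : Fin N, R ≤ b.val → b.val + 2 + R ≤ N → k₀ ≤ schur₀ (P.bondCurrent N b) J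

/-- **Hypothesis B₀ — the existence-free bulk backflow floor** (v10 form of `BulkBackflowFloorSig`): for every
`δ > 0` there is `R` with `∫₀^∞corr(J,J)/(N−1) − δ ≤ schur₀(j_b, J)` on every `R`-bulk bond of every `N`-chain — the
explicit Feshbach backflow `schur₀(j_b,J) − ∫₀^∞corr(j_b,J) = −a_bᵀG₀⁻¹A` (with `∫₀^∞corr(j_b,J) = ∫₀^∞corr(J,J)/(N−1)` by
`stub_lapZeroFlat`) is not macroscopically negative away from the contacts. Equivalent to `BulkBackflowFloorSig`
(`bulkBackflowFloor_of_floor0`, `bulkBackflowFloor0_of_floor`); implied by `OrthogonalOhm`. -/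
def BulkBackflowFloor0Sig : Prop :=
    ∀ ω₂ lam β γ : ℝ, 0 < ω₂ → 0 < lam → 0 < β → 0 < γ → ∀ T : ℝ, 0 < T → ∀ δ : ℝ, 0 < δ → ∃ R : ℕ, ∀ N : ℕ, 2 ≤ N →
      let P := Literature.MathematicalPhysics.KineticTheory.HeatConduction.pinnedChain ω₂ lam β γ
      let X := Literature.MathematicalPhysics.KineticTheory.HeatConduction.PhaseSpace N
      let μ : MeasureTheory.Measure X := P.gibbsMeasure N T
      let corr : (X → ℝ) → (X → ℝ) → ℝ → ℝ := fun f g t =>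
        (∫ z, f z * (∫ y, g y ∂(P.transitionKernel N T T t.toNNReal z)) ∂μ) - (∫ z, f z ∂μ) * (∫ z, g z ∂μ)
      let e : Fin N → X → ℝ := fun x z => z.2 x ^ 2 / 2 + P.U (z.1 x) +
        ∑ j : Fin N, ((if j.val = x.val + 1 then P.V (z.1 j - z.1 x) / 2 else 0) +
          (if x.val = j.val + 1 then P.V (z.1 x - z.1 j) / 2 else 0))
      let J : X → ℝ := fun z => ∑ i : Fin N, P.bondCurrent N i z
      let G₀ : Matrix (Fin N) (Fin N) ℝ := Matrix.of fun x y => ∫ t in Set.Ioi (0 : ℝ), corr (e x) (e y) t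
      let schur₀ : (X → ℝ) → (X → ℝ) → ℝ := fun f g =>
        (∫ t in Set.Ioi (0 : ℝ), corr f g t) -
          ∑ x : Fin N, ∑ y : Fin N, (∫ t in Set.Ioi (0 : ℝ), corr f (e x) t) * G₀⁻¹ x y *
            (∫ t in Set.Ioi (0 : ℝ), corr (e y) g t)
      ∀ b : Fin N, R ≤ b.val → b.val + 2 + R ≤ N →
        (∫ t in Set.Ioi (0 : ℝ), corr J J t) / ((N : ℝ) - 1) - δ ≤ schur₀ (P.bondCurrent N b) J

/-! ### v11 citations (everything below is a one-liner over LANDED theorems) -/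

/-- **Crux #3 ≡ its existence-free normal form, unconditionally** (`positiveMemory_iff_schur0Floor`, p152568). -/
theorem positiveMemory_iff_schur0FloorSig :
    Summit.AtomisticToContinuum.FouriersLaw.Theses.HonestZwanzig.PositiveMemory ↔ Schur0FloorSig :=
  positiveMemory_iff_schur0Floor

/-- `BulkBackflowFloor0Sig ↔ BulkBackflowFloorSig` (`bulkBackflowFloor_of_floor0`, `bulkBackflowFloor0_of_floor`, p153805). -/
theorem bulkBackflowFloor0Sig_iff : BulkBackflowFloor0Sig ↔ BulkBackflowFloorSig := by
  constructor
  · intro h₀ ω₂ lam β γ hω hl hβ hγ T hT δ hδ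
    obtain ⟨R, hR⟩ := h₀ ω₂ lam β γ hω hl hβ hγ T hT δ hδ
    refine ⟨R, fun N hN => ?_⟩
    have key := hR N hN
    have hex := tendsto_schur_bond_all ω₂ lam β γ hω hl hβ hγ T hT N hN
    have hrow := stub_rowLimit Summit.AtomisticToContinuum.FouriersLaw.Theorems.HonestZwanzig.stub_feshbachIdentities
      ω₂ lam β γ hω hl hβ hγ T hT N hN
    dsimp only at key hex hrow ⊢
    intro b hRb hbN ρ ℓ hρ hℓ
    have hb : b.val + 1 < N := by omega
    have hρeq : ρ = _ := tendsto_nhds_unique hρ (hex b)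
    have hℓeq : ℓ = _ := tendsto_nhds_unique hℓ (hrow b hb)
    rw [hρeq, hℓeq]
    exact key b hRb hbN
  · intro h ω₂ lam β γ hω hl hβ hγ T hT δ hδ
    obtain ⟨R, hR⟩ := h ω₂ lam β γ hω hl hβ hγ T hT δ hδ
    refine ⟨R, fun N hN => ?_⟩
    have key := hR N hN
    have hex := tendsto_schur_bond_all ω₂ lam β γ hω hl hβ hγ T hT N hN
    have hrow := stub_rowLimit Summit.AtomisticToContinuum.FouriersLaw.Theorems.HonestZwanzig.stub_feshbachIdentities
      ω₂ lam β γ hω hl hβ hγ T hT N hN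
    dsimp only at key hex hrow ⊢
    intro b hRb hbN
    have hb : b.val + 1 < N := by omega
    exact key b hRb hbN _ _ (hex b) (hrow b hb)

/-- `OrthogonalOhm → BulkBackflowFloor0Sig` (`bulkBackflowFloor0_of_orthogonalOhm`, p153805). -/
theorem bulkBackflowFloor0Sig_of_orthogonalOhm
    (hOO : Summit.AtomisticToContinuum.FouriersLaw.Theses.HonestZwanzig.OrthogonalOhm) : BulkBackflowFloor0Sig :=
  bulkBackflowFloor0Sig_iff.mpr (backflowFloor_of_orthogonalOhm hOO)

/-- `ConductanceLowerBound → EventualGreenKuboFloorSig` (`stub_eventualFloor_of_conductanceLowerBound`, p153109). -/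
theorem eventualFloorSig_of_conductanceLowerBound
    (hCLB : Summit.AtomisticToContinuum.FouriersLaw.Theses.JunctionLocality.ConductanceLowerBound) :
    EventualGreenKuboFloorSig :=
  stub_eventualFloor_of_conductanceLowerBound hCLB

/-- `FouriersLaw → EventualGreenKuboFloorSig` (`stub_eventualFloor_of_fouriersLaw`, p153109): the GK floor is summit-necessary. -/
theorem eventualFloorSig_of_fouriersLaw (hFL : _root_.FouriersLaw) : EventualGreenKuboFloorSig :=
  stub_eventualFloor_of_fouriersLaw hFL

/-- `MemoryConductivity → EventualGreenKuboFloorSig` (`eventualFloor_of_memoryConductivity`, p153805). -/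
theorem eventualFloorSig_of_memoryConductivity
    (hMC : Summit.AtomisticToContinuum.FouriersLaw.Theses.HonestZwanzig.MemoryConductivity) : EventualGreenKuboFloorSig := by
  intro ω₂ lam β γ hω hl hβ hγ T hT
  obtain ⟨k, hk, hlim⟩ := hMC ω₂ lam β γ hω hl hβ hγ T hT
  have hev := (tendsto_order.1 hlim).1 (k / 2) (by linarith)
  rw [Filter.eventually_atTop] at hev
  obtain ⟨N₁, hN₁⟩ := hev
  refine ⟨k / 2, by positivity, N₁, fun N hN1 hN2 => ?_⟩
  have h := hN₁ N hN1
  dsimp only at h ⊢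
  have hpos : (0 : ℝ) < (N : ℝ) - 1 := by
    have : (2 : ℝ) ≤ N := by exact_mod_cast hN2
    linarith
  rw [lt_div_iff₀ hpos] at h
  exact h.le

/-- Given cruxes #2 and #4: `PositiveMemory ↔ EventualGreenKuboFloorSig` (`positiveMemory_iff_eventualFloor`, p153805). -/
theorem positiveMemory_iff_eventualFloorSig
    (hOO : Summit.AtomisticToContinuum.FouriersLaw.Theses.HonestZwanzig.OrthogonalOhm)
    (hRC : Summit.AtomisticToContinuum.FouriersLaw.Theses.HonestZwanzig.RobinCoercivity) :
    Summit.AtomisticToContinuum.FouriersLaw.Theses.HonestZwanzig.PositiveMemory ↔ EventualGreenKuboFloorSig :=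
  ⟨fun hPM => eventualFloorSig_of_memoryConductivity
      (networkReduction_proof Summit.AtomisticToContinuum.FouriersLaw.Theorems.HonestZwanzig.generatorSiteEnergy_proof
        Summit.AtomisticToContinuum.FouriersLaw.Theorems.HonestZwanzig.parityStatics_proof
        Summit.AtomisticToContinuum.FouriersLaw.Theorems.HonestZwanzig.stub_feshbachIdentities hOO hPM hRC),
   fun hGK => positiveMemory_of_greenKuboFloor
      Summit.AtomisticToContinuum.FouriersLaw.Theorems.HonestZwanzig.stub_feshbachIdentities hOO hGK⟩

/-- `EventualGreenKuboFloorSig → BulkBackflowFloor0Sig → Schur0FloorSig` (`stub_schur0Floor_of_floors`, p153410). -/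
theorem schur0FloorSig_of_floors (hGK : EventualGreenKuboFloorSig) (hB₀ : BulkBackflowFloor0Sig) : Schur0FloorSig :=
  stub_schur0Floor_of_floors hGK hB₀

/-- **`EventualGreenKuboFloorSig → BulkBackflowFloor0Sig → PositiveMemory`** (`PositiveMemory_of_floors0`, p153805) — the
recommended existence-free, Schur-light pair of children for a split of crux #3 (both necessary given crux #2). Stated as
`id PositiveMemory` (see the NOTE above `PositiveMemory_of_locality`). -/
theorem PositiveMemory_of_floors0Sig (hGK : EventualGreenKuboFloorSig) (hB₀ : BulkBackflowFloor0Sig) :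
    id Summit.AtomisticToContinuum.FouriersLaw.Theses.HonestZwanzig.PositiveMemory :=
  positiveMemory_iff_schur0Floor.mpr (stub_schur0Floor_of_floors hGK hB₀)

/-- **`OrthogonalOhm → EventualGreenKuboFloorSig → PositiveMemory`** (`PositiveMemory_of_eventualFloor`, p153805 / p120416):
given crux #2, crux #3 IS the eventual Green–Kubo floor. Stated as `id PositiveMemory`. -/
theorem PositiveMemory_of_eventualFloorSig
    (hOO : Summit.AtomisticToContinuum.FouriersLaw.Theses.HonestZwanzig.OrthogonalOhm) (hGK : EventualGreenKuboFloorSig) :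
    id Summit.AtomisticToContinuum.FouriersLaw.Theses.HonestZwanzig.PositiveMemory :=
  positiveMemory_of_greenKuboFloor
    Summit.AtomisticToContinuum.FouriersLaw.Theorems.HonestZwanzig.stub_feshbachIdentities hOO hGK

/-- Exact Kirchhoff flatness at `s = 0` (`stub_lapZeroFlat`, p152799): `∫₀^∞corr(j_b, J) = ∫₀^∞corr(J,J)/(N−1)` on genuine bonds;
with it `BulkBackflowFloor0Sig` reads "the bulk entries of the explicit Feshbach backflow `a_bᵀG₀⁻¹A` are `≤ δ` beyond depth `R(δ)`". -/
theorem lapZeroFlat :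
    ∀ ω₂ lam β γ : ℝ, 0 < ω₂ → 0 < lam → 0 < β → 0 < γ → ∀ T : ℝ, 0 < T → ∀ N : ℕ, 2 ≤ N →
    let P := Literature.MathematicalPhysics.KineticTheory.HeatConduction.pinnedChain ω₂ lam β γ;
    let X := Literature.MathematicalPhysics.KineticTheory.HeatConduction.PhaseSpace N;
    let μ : MeasureTheory.Measure X := P.gibbsMeasure N T;
    let corr : (X → ℝ) → (X → ℝ) → ℝ → ℝ := fun f g t =>
      (∫ z, f z * (∫ y, g y ∂(P.transitionKernel N T T t.toNNReal z)) ∂μ) - (∫ z, f z ∂μ) * (∫ z, g z ∂μ);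
    let J : X → ℝ := fun z => ∑ i : Fin N, P.bondCurrent N i z;
    ∀ b : Fin N, b.val + 1 < N →
      (∫ t in Set.Ioi (0 : ℝ), corr (P.bondCurrent N b) J t) =
        (∫ t in Set.Ioi (0 : ℝ), corr J J t) / ((N : ℝ) - 1) :=
  stub_lapZeroFlat

/-! ### THE SKELETON THEOREM (v11, sorry-free): `OrthogonalOhm → ConductanceLowerBound → PositiveMemory` through the normal form -/

/-- **Skeleton theorem of line `Sketch`, v11 (sorry-free)**: `OrthogonalOhm → JunctionLocality.ConductanceLowerBound →
PositiveMemory`, derived through the existence-free normal form: the GK floor from stmt-11749 (p153109), the existence-free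
backflow floor from crux #2 (p153805 ∘ p122152), bookkeeping (p153410) and `positiveMemory_iff_schur0Floor` (p152568).
As a TYPE this implication is landed twice (`PositiveMemory_of_notInsulating` p120416, `PositiveMemory_of_subs'` p149463). -/
theorem PositiveMemory_of
    (hOO : Summit.AtomisticToContinuum.FouriersLaw.Theses.HonestZwanzig.OrthogonalOhm)
    (hCLB : Summit.AtomisticToContinuum.FouriersLaw.Theses.JunctionLocality.ConductanceLowerBound) :
    Summit.AtomisticToContinuum.FouriersLaw.Theses.HonestZwanzig.PositiveMemory :=
  positiveMemory_iff_schur0FloorSig.mpr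
    (schur0FloorSig_of_floors (eventualFloorSig_of_conductanceLowerBound hCLB) (bulkBackflowFloor0Sig_of_orthogonalOhm hOO))

end Summit.AtomisticToContinuum.FouriersLaw.Theorems.HonestZwanzig.PositiveMemory

end
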